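import Literature.AnabelianGeometry.AbsoluteAnabelian.AbsTopIProp23iGFGEngine
import Literature.AnabelianGeometry.SemiGraphs.ProSigmaFreeGroupIndexRigidity
import Literature.AnabelianGeometry.SemiGraphs.ProSigmaCompletionSlim
import Literature.AnabelianGeometry.AbsoluteAnabelian.FreeProSigmaTorsionFree
import Literature.GroupTheory.CombinatorialGroupTheory.PuncturedSurfaceGroupFree
import HarnessLib

/-!
# [AbsTopI] Prop 2.3 (i) at the GFG construction of Def 2.1 (i), AFFINE case: no finite normal subgroups, slim, elastic

S. Mochizuki, *Topics in Absolute Anabelian Geometry I: Generalities* (2012) [AbsTopI] (lit key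
`paper:url-11ac98ba15fc`), Def 2.1 (i) p. 17, Prop 2.3 (i) p. 19 ("`Δ` is slim and elastic"); Lemma 4.5 (i) p. 54.

THE MODEL (abc-iut-w6-d030's `AbsTopIProp23iGFGSurfaceModel.lean`, p440186, with the closed surface group replaced
by a FREE group): `Γ` free on `n ≥ 2` generators — the topological fundamental group `Γ_{g,r}` of an AFFINE
hyperbolic curve (`r ≥ 1`, `n = 2g + r − 1`); `P` profinite, `j : Γ → P` a pro-`Σ′` completion (`= π₁(X_k̄)`,
`Σ′ = 𝔓𝔯𝔦𝔪𝔢𝔰` in print), `U ⊴ P` open (`= π₁(Y_k̄)`), `π : P ↠ D` continuous with `ker π ≤ U` whose restriction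
`U ↠ π(U)` presents the maximal pro-`Σ` quotient of `U` (`Σ ⊆ Σ′`, `Σ` containing a prime) — so `D = Δ_X` of
Def 2.1 (i) and `π(U) = Ker(Δ_X → Gal(Y/X)) = U^Σ`.

THEOREMS (proof-only; no definition, no named fact; abc-iut-w6-d071, L4 row «P23i-FN-ORIGIN-GFG-MODEL-AFFINE»):
* `two_le_card_generators_of_finiteIndex`, `exists_mul_ne_mul_of_two_le_card_generators`,
  `isSlimGroup_of_isProSigmaCompletion_of_two_le` — (SLIM): finite-index subgroups of `Γ` are free of rank `≥ 2`
  (Schreier), hence nonabelian, so their profinite pro-`Σ` completions are slim (`IsProSigmaCompletion.isSlimGroup`);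
* `comap_le_comap_of_isProSigmaCompletion_restrict` — (RIGID): a profinite `Q` that is a pro-`Σ` completion of
  `j⁻¹V` and of `j⁻¹U ≤ j⁻¹V` (through the restriction) forces `j⁻¹V = j⁻¹U` — abc-iut-f-053's
  `index_eq_one_of_freeProlRank_eq` (p441608: Schreier's formula read on free pro-`ℓ` ranks);
* `centralizer_map_eq_bot` — **(T1) `Z_D(π(U)) = 1`** (the ENGINE `centralizer_map_eq_bot_of_slim_of_rigid` fed
  with (SLIM) + (RIGID)); `forall_isOfFinOrder_eq_one_map` — **(T2)** `π(U)` is torsion-free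
  (`isOfFinOrder_iff_of_isFreeGroup`); `forall_finite_normal_eq_bot` — **(T3)** `D` has no nontrivial finite
  normal subgroup (w6-d030's `finite_normal_eq_bot_of_torsionFree_of_centralizer_eq_bot`, p436548);
  `slim_and_elastic` — **(T4)** `D` is slim and elastic;
* `…_puncturedSurfaceGroup` — the same four for `Γ = Γ_{g,k+1}` hyperbolic (free on `2g + k ≥ 2` letters).

HONEST SCOPE: model-level, at the Def 2.1 (i) construction for AFFINE hyperbolic curves under the Riemann-existence
presentation of `π₁(X_k̄)`; the PROPER case is p440186; orbicurves and tame/char-`p` aspects outside.  Classical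
profinite group theory; OUR kernel check; nothing here bears on [IUTchIII] Cor. 3.12; no side is taken.
-/

noncomputable section

open Topology

universe u

namespace Literature.AnabelianGeometry.AbsoluteAnabelian

namespace GFGAffineModel

open Literature.AlgebraicGeometry.Frobenioids (IsSlimGroup)
open Literature.AnabelianGeometry.SemiGraphs (IsProSigma)
open Literature.AnabelianGeometry.SemiGraphs.PSCDatum (IsMaxProSigmaQuotient)
open Literature.AnabelianGeometry.SemiGraphs.SemiGraphOfAnabelioids
open Literature.AnabelianGeometry.SemiGraphs.SemiGraphOfAnabelioids.IsProSigmaCompletion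
open Literature.GroupTheory.CombinatorialGroupTheory
open Literature.GroupTheory.ProfiniteSubquotients

/-! ### Free groups: finite-index subgroups have rank `≥ 2` and are nonabelian -/

/-- Schreier: a finite-index subgroup `K` of a free group on `n ≥ 2` (finitely many) generators is free on
`[Γ : K](n − 1) + 1 ≥ 2` generators; in particular its set of free generators is finite and has at least two
elements. [cite: LyndonSchupp2001, Ch. I Prop. 3.9] -/
theorem two_le_card_generators_of_finiteIndex {Γ : Type*} [Group Γ] [IsFreeGroup Γ]
    [Finite (IsFreeGroup.Generators Γ)] (hn : 2 ≤ Nat.card (IsFreeGroup.Generators Γ)) (K : Subgroup Γ)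
    [K.FiniteIndex] :
    Finite (IsFreeGroup.Generators K) ∧ 2 ≤ Nat.card (IsFreeGroup.Generators K) := by
  have hSch := IsFreeGroup.card_generators_add_index K
  have hidx : 1 ≤ K.index := Nat.one_le_iff_ne_zero.mpr Subgroup.FiniteIndex.index_ne_zero
  have h2 : 2 ≤ Nat.card (IsFreeGroup.Generators K) := by
    have : K.index * 2 ≤ K.index * Nat.card (IsFreeGroup.Generators Γ) := Nat.mul_le_mul_left _ hn
    omega
  exact ⟨Nat.finite_of_card_ne_zero (by omega), h2⟩

/-- Two distinct free generators of a free group do not commute (checked in the symmetric group `S₃`); so a free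
group with at least two free generators is nonabelian. [cite: LyndonSchupp2001, Ch. I Prop. 3.9] -/
theorem exists_mul_ne_mul_of_two_le_card_generators {Γ : Type*} [Group Γ] [IsFreeGroup Γ]
    [Finite (IsFreeGroup.Generators Γ)] (hn : 2 ≤ Nat.card (IsFreeGroup.Generators Γ)) :
    ∃ x y : Γ, x * y ≠ y * x := by
  classical
  have hnt : Nontrivial (IsFreeGroup.Generators Γ) := by
    rw [← Finite.one_lt_card_iff_nontrivial]; omega
  obtain ⟨a, b, hab⟩ := hnt
  refine ⟨IsFreeGroup.of a, IsFreeGroup.of b, fun heq => ?_⟩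
  let s : IsFreeGroup.Generators Γ → Equiv.Perm (Fin 3) := fun w =>
    if w = a then Equiv.swap 0 1 else if w = b then Equiv.swap 1 2 else 1
  have hsa : s a = Equiv.swap 0 1 := by simp [s]
  have hsb : s b = Equiv.swap 1 2 := by simp [s, Ne.symm hab]
  have h3 := congrArg (IsFreeGroup.lift s) heq
  rw [map_mul, map_mul, IsFreeGroup.lift_of, IsFreeGroup.lift_of, hsa, hsb] at h3
  exact absurd h3 (by decide)

/-- **(SLIM) for free groups**: a profinite pro-`Σ` completion of a free group with at least two (finitely many)
free generators is slim ([AbsAnab] Lemma 1.3.1, affine case: `IsProSigmaCompletion.isSlimGroup`).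
[cite: MochizukiAbsAnab2004, Lemma 1.3.1 p.15] -/
theorem isSlimGroup_of_isProSigmaCompletion_of_two_le {Sigma : Set ℕ} {Γ : Type*} [Group Γ] [IsFreeGroup Γ]
    [Finite (IsFreeGroup.Generators Γ)] (hn : 2 ≤ Nat.card (IsFreeGroup.Generators Γ))
    {Q : Type*} [Group Q] [TopologicalSpace Q] [IsTopologicalGroup Q] [CompactSpace Q] [T2Space Q]
    [TotallyDisconnectedSpace Q] {φ : Γ →* Q} (hφ : IsProSigmaCompletion Sigma φ) : IsSlimGroup Q :=
  hφ.isSlimGroup (exists_mul_ne_mul_of_two_le_card_generators hn)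

variable {Sigma Sigma' : Set ℕ} {Γ : Type*} [Group Γ] [IsFreeGroup Γ] [Finite (IsFreeGroup.Generators Γ)]
  {P : Type u} [Group P] [TopologicalSpace P] [IsTopologicalGroup P] [CompactSpace P]
  [TotallyDisconnectedSpace P]
  {D : Type u} [Group D] [TopologicalSpace D] [IsTopologicalGroup D] [CompactSpace D] [T2Space D]
  [TotallyDisconnectedSpace D]
  {j : Γ →* P} {π : P →* D} {U : Subgroup P}

/-! ### (RIGID) for free groups: pro-`Σ` completions detect the index -/

/-- **(RIGID) for free groups.**  `Γ` free on `n ≥ 2` generators, `j : Γ → P` a pro-`Σ′` completion (`P`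
profinite), `U ≤ V` open subgroups of `P`, and a profinite `Q` that is a pro-`Σ` completion of `j⁻¹V` through `φ`
AND of `j⁻¹U` through `φ|_{j⁻¹U}` (`Σ` containing a prime `ℓ`): then `j⁻¹V ≤ j⁻¹U` — by abc-iut-f-053's
`index_eq_one_of_freeProlRank_eq` (p441608) applied to the free group `j⁻¹V` and its finite-index subgroup `j⁻¹U`
(both ranks are `δ¹_ℓ(Q)`). [cite: MochizukiAbsTopI2012, Prop 2.3 (i) p.19] -/
theorem comap_le_comap_of_isProSigmaCompletion_restrict (hn : 2 ≤ Nat.card (IsFreeGroup.Generators Γ))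
    (hj : IsProSigmaCompletion Sigma' j) (hS : ∃ ℓ ∈ Sigma, ℓ.Prime) (hUo : IsOpen (U : Set P))
    (V : Subgroup P) (hVo : IsOpen (V : Set P)) (hUV : U ≤ V)
    {Q : Type*} [Group Q] [TopologicalSpace Q] [IsTopologicalGroup Q] [CompactSpace Q]
    (φ : V.comap j →* Q) (hφ : IsProSigmaCompletion Sigma φ)
    (hφ' : IsProSigmaCompletion Sigma (φ.comp (Subgroup.inclusion (Subgroup.comap_mono hUV)))) :
    V.comap j ≤ U.comap j := by
  obtain ⟨ℓ, hℓS, hℓ⟩ := hS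
  haveI : Fact ℓ.Prime := ⟨hℓ⟩
  haveI : (U.comap j).FiniteIndex := finiteIndex_comap hj U hUo
  haveI : (V.comap j).FiniteIndex := finiteIndex_comap hj V hVo
  -- the free group `Γ₂ := j⁻¹V` (Nielsen–Schreier), of rank `≥ 2`, and its finite-index subgroup `K := j⁻¹U`
  obtain ⟨hfin, hn₂⟩ := two_le_card_generators_of_finiteIndex hn (V.comap j)
  haveI := hfin
  let K : Subgroup (V.comap j) := (U.comap j).subgroupOf (V.comap j)
  let eK : K ≃* (U.comap j : Subgroup Γ) := Subgroup.subgroupOfEquivOfLe (Subgroup.comap_mono hUV)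
  have hι₁ : IsProSigmaCompletion Sigma
      ((φ.comp (Subgroup.inclusion (Subgroup.comap_mono hUV))).comp eK.toMonoidHom) :=
    hφ'.of_comp_mulEquiv eK fun _ => rfl
  have hK : K.index = 1 := index_eq_one_of_freeProlRank_eq hn₂ K hι₁ hφ hℓS rfl
  exact Subgroup.subgroupOf_eq_top.mp (Subgroup.index_eq_one.mp hK)

/-! ### (T1)–(T4) at the affine GFG construction -/

/-- **(T1) `Z_D(U^Σ) = 1` at the GFG construction of [AbsTopI] Def 2.1 (i), AFFINE case** (`Γ` free on `n ≥ 2`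
generators, `Σ ⊆ Σ′`, `Σ` containing a prime): the centraliser in `D = Δ_X` of `π(U) = Ker(Δ_X → Gal(Y/X))` is
trivial — `Gal(Y/X)` acts outer-faithfully on `U^Σ`.  The ENGINE `centralizer_map_eq_bot_of_slim_of_rigid` with
(SLIM) `isSlimGroup_of_isProSigmaCompletion_of_two_le` and (RIGID) `comap_le_comap_of_isProSigmaCompletion_restrict`.
[cite: MochizukiAbsTopI2012, Prop 2.3 (i) p.19] -/
theorem centralizer_map_eq_bot (hn : 2 ≤ Nat.card (IsFreeGroup.Generators Γ)) (hSS : Sigma ⊆ Sigma')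
    (hS : ∃ ℓ ∈ Sigma, ℓ.Prime) (hj : IsProSigmaCompletion Sigma' j) [U.Normal] (hUo : IsOpen (U : Set P))
    (hπc : Continuous π) (hπs : Function.Surjective π) (hker : π.ker ≤ U)
    (hmax : IsMaxProSigmaQuotient Sigma (π.subgroupMap U)) :
    Subgroup.centralizer ((U.map π : Subgroup D) : Set D) = ⊥ := by
  refine GFGSurfaceModel.centralizer_map_eq_bot_of_slim_of_rigid hSS hj hUo hπc hπs hker hmax ?_ ?_
  · intro V hVo _ Q _ _ _ _ _ _ φ hφ
    haveI : (V.comap j).FiniteIndex := finiteIndex_comap hj V hVo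
    obtain ⟨hfin, hn₂⟩ := two_le_card_generators_of_finiteIndex hn (V.comap j)
    haveI := hfin
    exact isSlimGroup_of_isProSigmaCompletion_of_two_le hn₂ hφ
  · intro V hVo hUV Q _ _ _ _ _ _ φ hφ hφ'
    exact comap_le_comap_of_isProSigmaCompletion_restrict hn hj hS hUo V hVo hUV φ hφ hφ'

omit [Finite (IsFreeGroup.Generators Γ)] in
/-- **(T2)** `π(U) = U^Σ` is torsion-free — a pro-`Σ` completion of the free group `j⁻¹U`
(`isOfFinOrder_iff_of_isFreeGroup`; [AbsTopI] Lemma 4.5 (i)). [cite: MochizukiAbsTopI2012, Lemma 4.5 (i) p.54] -/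
theorem forall_isOfFinOrder_eq_one_map (hSS : Sigma ⊆ Sigma') (hj : IsProSigmaCompletion Sigma' j)
    (hUo : IsOpen (U : Set P)) (hπc : Continuous π) (hmax : IsMaxProSigmaQuotient Sigma (π.subgroupMap U)) :
    ∀ d ∈ U.map π, IsOfFinOrder d → d = 1 := by
  haveI : CompactSpace (U.map π) := compactSpace_of_isClosed (GFGSurfaceModel.isClosed_map hUo hπc)
  have hιU := GFGSurfaceModel.isProSigmaCompletion_map hSS hj hUo hπc hmax
  intro d hd hfin
  have hfin' : IsOfFinOrder (⟨d, hd⟩ : U.map π) :=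
    (Subgroup.subtype_injective _).isOfFinOrder_iff.mp (by simpa using hfin)
  have := (isOfFinOrder_iff_of_isFreeGroup hιU).mp hfin'
  simpa using congrArg Subtype.val this

/-- **(T3) `Δ_X` has no nontrivial finite normal subgroup** at the affine GFG construction — the hypothesis (FN) of
the slimness ascent (`ProfiniteSlimAscent.lean`, p433420) DISCHARGED, via w6-d030's
`finite_normal_eq_bot_of_torsionFree_of_centralizer_eq_bot` with the torsion-free normal subgroup `π(U)` of trivial
centraliser. [cite: MochizukiAbsTopI2012, Prop 2.3 (i) p.19] -/
theorem forall_finite_normal_eq_bot (hn : 2 ≤ Nat.card (IsFreeGroup.Generators Γ)) (hSS : Sigma ⊆ Sigma')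
    (hS : ∃ ℓ ∈ Sigma, ℓ.Prime) (hj : IsProSigmaCompletion Sigma' j) [U.Normal] (hUo : IsOpen (U : Set P))
    (hπc : Continuous π) (hπs : Function.Surjective π) (hker : π.ker ≤ U)
    (hmax : IsMaxProSigmaQuotient Sigma (π.subgroupMap U)) :
    ∀ N : Subgroup D, N.Normal → (N : Set D).Finite → N = ⊥ :=
  haveI : (U.map π).Normal := Subgroup.Normal.map inferInstance π hπs
  finite_normal_eq_bot_of_torsionFree_of_centralizer_eq_bot (U.map π)
    (forall_isOfFinOrder_eq_one_map hSS hj hUo hπc hmax)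
    (centralizer_map_eq_bot hn hSS hS hj hUo hπc hπs hker hmax)

/-- `π(U)` is elastic: a pro-`Σ` completion of the free group `j⁻¹U` of rank `≥ 2`
(`isElastic_of_isProSigmaCompletion_freeGroup`, transported along `IsFreeGroup.toFreeGroup`).
[cite: MochizukiAbsTopI2012, Prop 2.3 (i) p.19] -/
theorem isElastic_map (hn : 2 ≤ Nat.card (IsFreeGroup.Generators Γ)) (hSS : Sigma ⊆ Sigma')
    (hS : ∃ ℓ ∈ Sigma, ℓ.Prime) (hj : IsProSigmaCompletion Sigma' j) (hUo : IsOpen (U : Set P))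
    (hπc : Continuous π) (hmax : IsMaxProSigmaQuotient Sigma (π.subgroupMap U)) :
    IsElastic (U.map π) := by
  classical
  haveI : CompactSpace (U.map π) := compactSpace_of_isClosed (GFGSurfaceModel.isClosed_map hUo hπc)
  haveI : (U.comap j).FiniteIndex := finiteIndex_comap hj U hUo
  obtain ⟨hfin, hn₂⟩ := two_le_card_generators_of_finiteIndex hn (U.comap j)
  haveI := hfin
  letI : Fintype (IsFreeGroup.Generators (U.comap j)) := Fintype.ofFinite _
  have hιU := GFGSurfaceModel.isProSigmaCompletion_map hSS hj hUo hπc hmax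
  -- transport along `j⁻¹U ≅ F(Generators j⁻¹U)`
  let e : FreeGroup (IsFreeGroup.Generators (U.comap j)) ≃* (U.comap j : Subgroup Γ) :=
    (IsFreeGroup.toFreeGroup (U.comap j)).symm
  have hι' : IsProSigmaCompletion Sigma (((π.subgroupMap U).comp (j.subgroupComap U)).comp e.toMonoidHom) :=
    hιU.of_comp_mulEquiv e fun _ => rfl
  have hcard : 2 ≤ Fintype.card (IsFreeGroup.Generators (U.comap j)) := by
    rwa [← Nat.card_eq_fintype_card]
  exact isElastic_of_isProSigmaCompletion_freeGroup hcard hι' hS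

/-- **(T4) [AbsTopI] Prop 2.3 (i) at the affine GFG construction: `Δ_X` is slim and elastic**, UNCONDITIONALLY at this
model — w6-d030's ascent `slim_and_elastic_of_isOpen_normal_torsionFree` (p436548 over p433420/p432240) fed with the
open normal free pro-`Σ` group `π(U)` (slim (SLIM); elastic `isElastic_map`; torsion-free (T2); trivial centraliser
(T1)). [cite: MochizukiAbsTopI2012, Prop 2.3 (i) p.19] -/
theorem slim_and_elastic (hn : 2 ≤ Nat.card (IsFreeGroup.Generators Γ)) (hSS : Sigma ⊆ Sigma')
    (hS : ∃ ℓ ∈ Sigma, ℓ.Prime) (hj : IsProSigmaCompletion Sigma' j) [U.Normal] (hUo : IsOpen (U : Set P))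
    (hπc : Continuous π) (hπs : Function.Surjective π) (hker : π.ker ≤ U)
    (hmax : IsMaxProSigmaQuotient Sigma (π.subgroupMap U)) : IsSlimGroup D ∧ IsElastic D := by
  haveI : (U.map π).Normal := Subgroup.Normal.map inferInstance π hπs
  haveI : CompactSpace (U.map π) := compactSpace_of_isClosed (GFGSurfaceModel.isClosed_map hUo hπc)
  haveI : (U.comap j).FiniteIndex := finiteIndex_comap hj U hUo
  obtain ⟨hfin, hn₂⟩ := two_le_card_generators_of_finiteIndex hn (U.comap j)
  haveI := hfin
  have hιU := GFGSurfaceModel.isProSigmaCompletion_map hSS hj hUo hπc hmax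
  exact slim_and_elastic_of_isOpen_normal_torsionFree (U.map π) (GFGSurfaceModel.isOpen_map hUo hπc hπs hker)
    (isSlimGroup_of_isProSigmaCompletion_of_two_le hn₂ hιU) (isElastic_map hn hSS hS hj hUo hπc hmax)
    (forall_isOfFinOrder_eq_one_map hSS hj hUo hπc hmax)
    (centralizer_map_eq_bot hn hSS hS hj hUo hπc hπs hker hmax)

end GFGAffineModel

/-! ### The punctured surface groups `Γ_{g,k+1}` (free on `2g + k` letters) -/

namespace GFGAffineModel

open Literature.AlgebraicGeometry.Frobenioids (IsSlimGroup)
open Literature.AnabelianGeometry.SemiGraphs.PSCDatum (IsMaxProSigmaQuotient)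
open Literature.AnabelianGeometry.SemiGraphs.SemiGraphOfAnabelioids
open Literature.GroupTheory.CombinatorialGroupTheory

variable {Sigma Sigma' : Set ℕ} {g k : ℕ}
  {P : Type u} [Group P] [TopologicalSpace P] [IsTopologicalGroup P] [CompactSpace P]
  [TotallyDisconnectedSpace P]
  {D : Type u} [Group D] [TopologicalSpace D] [IsTopologicalGroup D] [CompactSpace D] [T2Space D]
  [TotallyDisconnectedSpace D]
  {j : PuncturedSurfaceGroup g (k + 1) →* P} {π : P →* D} {U : Subgroup P}

/-- `Γ_{g,k+1}` is free (`PuncturedSurfaceGroup.nonempty_mulEquiv_freeGroup`) on `2g + k` generators; for a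
hyperbolic type, `2g + k ≥ 2`.  Packaged as: an `IsFreeGroup` structure with finitely many, and at least two,
free generators. [cite: MochizukiSemiAnbd2006, Ex. 2.10 p.31] -/
theorem exists_isFreeGroup_puncturedSurfaceGroup (hgk : PuncturedSurfaceGroup.IsHyperbolicType g (k + 1)) :
    ∃ _ : IsFreeGroup (PuncturedSurfaceGroup g (k + 1)),
      Finite (IsFreeGroup.Generators (PuncturedSurfaceGroup g (k + 1))) ∧
        2 ≤ Nat.card (IsFreeGroup.Generators (PuncturedSurfaceGroup g (k + 1))) := by
  classical
  obtain ⟨e⟩ := PuncturedSurfaceGroup.nonempty_mulEquiv_freeGroup g k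
  letI hF : IsFreeGroup (PuncturedSurfaceGroup g (k + 1)) := IsFreeGroup.ofMulEquiv e.symm
  let eg : (Fin g × Bool ⊕ Fin k) ≃ IsFreeGroup.Generators (PuncturedSurfaceGroup g (k + 1)) :=
    Equiv.ofFreeGroupEquiv (e.symm.trans (IsFreeGroup.toFreeGroup (PuncturedSurfaceGroup g (k + 1))))
  have hcard : Nat.card (IsFreeGroup.Generators (PuncturedSurfaceGroup g (k + 1))) = 2 * g + k := by
    rw [← Nat.card_congr eg, Nat.card_eq_fintype_card, Fintype.card_sum, Fintype.card_prod, Fintype.card_fin,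
      Fintype.card_bool, Fintype.card_fin]
    ring
  refine ⟨hF, Finite.of_equiv _ eg, ?_⟩
  rw [hcard]
  unfold PuncturedSurfaceGroup.IsHyperbolicType at hgk
  omega

/-- **(T1) for `Γ_{g,k+1}`**: at the GFG construction of Def 2.1 (i) over a pro-`Σ′` completion of a hyperbolic
punctured surface group, `Z_{Δ_X}(U^Σ) = 1`. [cite: MochizukiAbsTopI2012, Prop 2.3 (i) p.19] -/
theorem centralizer_map_eq_bot_puncturedSurfaceGroup (hgk : PuncturedSurfaceGroup.IsHyperbolicType g (k + 1))
    (hSS : Sigma ⊆ Sigma') (hS : ∃ ℓ ∈ Sigma, ℓ.Prime) (hj : IsProSigmaCompletion Sigma' j) [U.Normal]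
    (hUo : IsOpen (U : Set P)) (hπc : Continuous π) (hπs : Function.Surjective π) (hker : π.ker ≤ U)
    (hmax : IsMaxProSigmaQuotient Sigma (π.subgroupMap U)) :
    Subgroup.centralizer ((U.map π : Subgroup D) : Set D) = ⊥ := by
  obtain ⟨hF, hfin, hn⟩ := exists_isFreeGroup_puncturedSurfaceGroup hgk
  haveI := hF; haveI := hfin
  exact centralizer_map_eq_bot hn hSS hS hj hUo hπc hπs hker hmax

/-- **(T3) for `Γ_{g,k+1}`**: `Δ_X` has no nontrivial finite normal subgroup. [cite: MochizukiAbsTopI2012, Prop 2.3 (i) p.19] -/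
theorem forall_finite_normal_eq_bot_puncturedSurfaceGroup (hgk : PuncturedSurfaceGroup.IsHyperbolicType g (k + 1))
    (hSS : Sigma ⊆ Sigma') (hS : ∃ ℓ ∈ Sigma, ℓ.Prime) (hj : IsProSigmaCompletion Sigma' j) [U.Normal]
    (hUo : IsOpen (U : Set P)) (hπc : Continuous π) (hπs : Function.Surjective π) (hker : π.ker ≤ U)
    (hmax : IsMaxProSigmaQuotient Sigma (π.subgroupMap U)) :
    ∀ N : Subgroup D, N.Normal → (N : Set D).Finite → N = ⊥ := by
  obtain ⟨hF, hfin, hn⟩ := exists_isFreeGroup_puncturedSurfaceGroup hgk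
  haveI := hF; haveI := hfin
  exact forall_finite_normal_eq_bot hn hSS hS hj hUo hπc hπs hker hmax

/-- **(T4) for `Γ_{g,k+1}`: [AbsTopI] Prop 2.3 (i) "`Δ` is slim and elastic"** at the Def 2.1 (i) GFG construction
over a pro-`Σ′` completion of a hyperbolic punctured surface group `Γ_{g,k+1}` — UNCONDITIONAL at this model.
[cite: MochizukiAbsTopI2012, Prop 2.3 (i) p.19] -/
theorem slim_and_elastic_puncturedSurfaceGroup (hgk : PuncturedSurfaceGroup.IsHyperbolicType g (k + 1))
    (hSS : Sigma ⊆ Sigma') (hS : ∃ ℓ ∈ Sigma, ℓ.Prime) (hj : IsProSigmaCompletion Sigma' j) [U.Normal]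
    (hUo : IsOpen (U : Set P)) (hπc : Continuous π) (hπs : Function.Surjective π) (hker : π.ker ≤ U)
    (hmax : IsMaxProSigmaQuotient Sigma (π.subgroupMap U)) : IsSlimGroup D ∧ IsElastic D := by
  obtain ⟨hF, hfin, hn⟩ := exists_isFreeGroup_puncturedSurfaceGroup hgk
  haveI := hF; haveI := hfin
  exact slim_and_elastic hn hSS hS hj hUo hπc hπs hker hmax

end GFGAffineModel

end Literature.AnabelianGeometry.AbsoluteAnabelian

end
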